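import Summits.AtomisticToContinuum.HydrodynamicLimit.Theorems.CollisionIsometryCLTAdaptedWeightCLTSAReynoldsStatics
import Summits.AtomisticToContinuum.HydrodynamicLimit.Theorems.CollisionIsometryCLTAdaptedWeightCLTCBTimeZero
import Summits.AtomisticToContinuum.HydrodynamicLimit.Theorems.CollisionIsometryCLTAdaptedWeightCLTCBEqRungDynamics
import Literature.MathematicalPhysics.KineticTheory.DiPernaLionsExpDuhamel

/-!
# Equilibrium rung of `stub_reynolds` (line `sustained-anisotropy-superexp`, crux stmt-AtomisticToContinuum-14868):
# the sub-block Reynolds remainder vanishes in probability at constant profiles, for every flow and every horizon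

Support file (`--supports stmt-AtomisticToContinuum-14868`, anchor = the registered helper `stub_reynolds_const`) of the
stub worker of `stub_reynolds`; final file of the EQUILIBRIUM RUNG of the sub-block
Reynolds remainder (`…SAReynoldsPacking`, `…Gauss`, `…Statics`). MAIN RESULT (`reynolds_const` = `stub_reynolds_const`
verbatim): at constant profiles `(a, u, θ)`, `0 < a`, `0 < θ`, for every `0 < σ < 1/2`, EVERY hard-sphere flow family `Φ`,
every admissible block kernel family (`γ ≤ 1/15`), every cell kernel family, every horizon `t > 0` and `κ > 0`,

  `P_N {κ < ReynInt σ N (Φ N) φ ψ t} → 0`,   `P_N = localGibbsLaw σ a u θ N (Φ N)`,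

with NO hypothesis (neither H1 `DiffuseAt` nor H2 `TailsOn`): the `m = 0` rung of `stub_reynolds` (the line's declared
exposure) and the equilibrium consistency check that `ReynInt = ∫₀ᵗ∫ₓ ethC · reyC` is typed correctly (thermal share
`≍ θ Σⱼ pᵢⱼ² → 0` UNIFORMLY in the positions, `…SAReynoldsPacking`; no position law of large numbers is used).

Steps. (1) STATIC MEAN (`exists_lintegral_reynolds_le`): the static bound at fixed positions and block centre
(`Reynolds.lintegral_ethC_mul_reyC_zip_le`) is integrated over the block centre (`∫ₓ φ_N(p_k − x) dx = 1` turns the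
position-dependent term into the mean cell self-share `(N+1)⁻¹ Σ_k S_k`), then against the position marginal of the local
Gibbs law (`lintegral_localGibbsMeasure`, mass one) with the density cap `TimeZero.density_cap` and
`w_max/(N+1) = C (N+1)^{3γ−1} → 0`; `ε` and the self-share threshold are tuned to `η`: `E_{G_N} ∫ₓ ethC · reyC ≤ η`
eventually in `N`, for every flow. (2) DYNAMICS (`reynolds_const`): `G_N` is invariant under every flow map
(`measurePreserving_flow_localGibbsLaw_const`), so Markov's inequality applied DIRECTLY to the time integral (first
moments only: `ofReal` of a Bochner integral is below the lower integral, Tonelli in `(z, s)` on the jointly measurable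
modification of the flow `measurable_flowMod`, invariance slice by slice) gives `P_N{κ < ReynInt} ≤ η t/κ` eventually.
No definitions are introduced (pure proof file). References: H. Spohn, *Large Scale Dynamics of Interacting Particles* (1991), Part I §2.3 [Spohn1991].
-/

namespace Summit.AtomisticToContinuum.HydrodynamicLimit.Theorems.SustainedAnisotropy

open scoped BigOperators Topology Classical MeasureTheory ENNReal InnerProductSpace
open Filter Set MeasureTheory ProbabilityTheory
open Literature.Analysis.FluidPDE
open Summit.AtomisticToContinuum.HydrodynamicLimit.Theorems.ContactSourceDuhamel
open Summit.AtomisticToContinuum.HydrodynamicLimit.Theorems.ContactSourceDuhamel.TimeLocal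
open Summit.AtomisticToContinuum.HydrodynamicLimit.Theorems.ContactBalance
open Literature.MathematicalPhysics.KineticTheory (gaussMeasure hsDiameter localGibbsLaw localGibbsLaw_eq
  localGibbsMeasure lintegral_localGibbsMeasure lintegral_posWeight_eq_one zipConfig zipConfig_apply
  posWeight posDomain zipConfig_mem_hardSphereDomain_iff measurable_posWeight localGibbsProfile
  isProbabilityMeasure_localGibbsMeasure measurable_zipConfig isProbabilityMeasure_localGibbsLaw
  localGibbsLaw_absolutelyContinuous ofReal_integral_le_lintegral)

noncomputable section

namespace Reynolds

/-! ## Integration over the block centre at fixed positions -/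

section XIntegral

variable {ψ : ℕ → T3 → ℝ} {ℓ : ℕ → ℝ} {γ C : ℝ} {φ : ℕ → T3 → ℝ} (u : V3) {θ : ℝ}

/-- `∫ₓ (N+1)⁻¹ Σ_k φ_N(p_k − x) S_k dx = (N+1)⁻¹ Σ_k S_k` (unit mass of the block kernel, Haar invariance). -/
theorem integral_blockShare (hadm : AdmissibleKernel γ C φ) (N : ℕ) (p : Fin (N + 1) → T3) (S : Fin (N + 1) → ℝ) :
    ∫ x, ((N + 1 : ℕ) : ℝ)⁻¹ * ∑ k, φ N (p k - x) * S k = ((N + 1 : ℕ) : ℝ)⁻¹ * ∑ k, S k := by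
  have hint : ∀ k, Integrable (fun x : T3 => φ N (p k - x) * S k) := fun k =>
    (PastDamping.integrable_of_continuous_T3 ((hadm.1 N).continuous.comp (continuous_const.sub continuous_id))).mul_const _
  rw [integral_const_mul, integral_finsetSum _ fun k _ => hint k]
  congr 1
  refine Finset.sum_congr rfl fun k _ => ?_
  rw [integral_mul_const, PastDamping.integral_comp_sub_left (φ N) (p k), hadm.2.2.1 N, one_mul]

/-- The block-centre integral of the static bound at fixed positions `p` whose blocks all obey the density cap:
`∫ₓ E_v (ethC · reyC) ≤ √K₀ ((3θ/ε) Dcap ((N+1)⁻¹ Σ_k S_k + w_max/(N+1)) + Dcap² ε/2)` (lower integrals). -/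
theorem lintegral_lintegral_zip_le (hθ : 0 < θ) (hψ : CellKernel ψ ℓ) (hadm : AdmissibleKernel γ C φ) (N : ℕ)
    (p : Fin (N + 1) → T3) {Dcap ε : ℝ} (hε : 0 < ε) (hDcap : 0 ≤ Dcap)
    (hcap : ∀ x : T3, (∑ j, φ N (p j - x)) / ((N + 1 : ℕ) : ℝ) ≤ Dcap) :
    ∫⁻ v, ∫⁻ x, ENNReal.ofReal (ethC N φ ψ (zipConfig (p, v)) x * reyC N φ ψ (zipConfig (p, v)) x)
        ∂(volume : Measure T3) ∂(Measure.pi fun _ : Fin (N + 1) => gaussMeasure u θ) ≤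
      ENNReal.ofReal (Real.sqrt (104 * (1 + 2 ^ 16 * ∫ w, ‖w - u‖ ^ 16 ∂gaussMeasure u θ)) *
        (3 * θ / ε * Dcap * (((N + 1 : ℕ) : ℝ)⁻¹ * ∑ k, ∑ j, (ψ N (p j - p k) / ∑ m, ψ N (p m - p k)) ^ 2 +
            C * ((N : ℝ) + 1) ^ (3 * γ) / ((N + 1 : ℕ) : ℝ)) + Dcap ^ 2 * ε / 2)) := by
  set μ := Measure.pi fun _ : Fin (N + 1) => gaussMeasure u θ with hμ
  set K : ℝ := Real.sqrt (104 * (1 + 2 ^ 16 * ∫ w, ‖w - u‖ ^ 16 ∂gaussMeasure u θ)) with hK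
  set S : Fin (N + 1) → ℝ := fun k => ∑ j, (ψ N (p j - p k) / ∑ m, ψ N (p m - p k)) ^ 2 with hS
  set wM : ℝ := C * ((N : ℝ) + 1) ^ (3 * γ) / ((N + 1 : ℕ) : ℝ) with hwM
  have hφc : Continuous (φ N) := (hadm.1 N).continuous
  have hψc : Continuous (ψ N) := hψ.1 N
  have hφ0 : ∀ y, 0 ≤ φ N y := hadm.2.1 N
  have hC0 : 0 ≤ C := Pointwise.admissible_C_nonneg hadm
  have hK0 : 0 ≤ K := Real.sqrt_nonneg _
  have hS0 : ∀ k, 0 ≤ S k := fun k => Finset.sum_nonneg fun j _ => sq_nonneg _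
  have hwM0 : 0 ≤ wM := div_nonneg (mul_nonneg hC0 (Real.rpow_nonneg (by positivity) _)) (by positivity)
  -- Tonelli in `(v, x)`
  have hmeas : AEMeasurable (Function.uncurry fun (v : Fin (N + 1) → V3) (x : T3) =>
      ENNReal.ofReal (ethC N φ ψ (zipConfig (p, v)) x * reyC N φ ψ (zipConfig (p, v)) x))
      (μ.prod (volume : Measure T3)) := by
    have hz : Measurable fun q : (Fin (N + 1) → V3) × T3 => (zipConfig (p, q.1), q.2) :=
      (measurable_zipConfig.comp (measurable_const.prodMk measurable_fst)).prodMk measurable_snd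
    have h := ((measurable_ethC_mul_reyC_prod (N := N) (φ := φ) (ψ := ψ) hφc hψc).ennreal_ofReal.comp hz)
    refine Measurable.aemeasurable ?_
    simpa only [Function.comp_def, Function.uncurry_def] using h
  rw [lintegral_lintegral_swap hmeas]
  -- the static bound per block centre, then the Bochner integral of the continuous bound
  set F : T3 → ℝ := fun x => ((N + 1 : ℕ) : ℝ)⁻¹ * ∑ k, φ N (p k - x) * S k with hF
  have hFc : Continuous F := by rw [hF]; fun_prop
  have hF0 : ∀ x, 0 ≤ F x := fun x =>
    mul_nonneg (by positivity) (Finset.sum_nonneg fun k _ => mul_nonneg (hφ0 _) (hS0 k))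
  have hpt : ∀ x, ∫⁻ v, ENNReal.ofReal (ethC N φ ψ (zipConfig (p, v)) x * reyC N φ ψ (zipConfig (p, v)) x) ∂μ ≤
      ENNReal.ofReal (K * (3 * θ / ε * Dcap * (F x + wM) + Dcap ^ 2 * ε / 2)) := fun x =>
    lintegral_ethC_mul_reyC_zip_le u hθ hψ hadm N p x hε (hcap x)
  have hint : Integrable (fun x => K * (3 * θ / ε * Dcap * (F x + wM) + Dcap ^ 2 * ε / 2)) (volume : Measure T3) :=
    PastDamping.integrable_of_continuous_T3 (by fun_prop)
  have hnn : ∀ x, 0 ≤ K * (3 * θ / ε * Dcap * (F x + wM) + Dcap ^ 2 * ε / 2) := fun x => by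
    have := hF0 x
    positivity
  calc ∫⁻ x, ∫⁻ v, ENNReal.ofReal (ethC N φ ψ (zipConfig (p, v)) x * reyC N φ ψ (zipConfig (p, v)) x) ∂μ
        ∂(volume : Measure T3)
      ≤ ∫⁻ x, ENNReal.ofReal (K * (3 * θ / ε * Dcap * (F x + wM) + Dcap ^ 2 * ε / 2)) ∂(volume : Measure T3) :=
        lintegral_mono hpt
    _ = ENNReal.ofReal (∫ x, K * (3 * θ / ε * Dcap * (F x + wM) + Dcap ^ 2 * ε / 2) ∂(volume : Measure T3)) :=
        (ofReal_integral_eq_lintegral_ofReal hint (ae_of_all _ hnn)).symm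
    _ = ENNReal.ofReal (K * (3 * θ / ε * Dcap * (((N + 1 : ℕ) : ℝ)⁻¹ * ∑ k, S k + wM) + Dcap ^ 2 * ε / 2)) := by
        congr 1
        have hFi : Integrable F (volume : Measure T3) := PastDamping.integrable_of_continuous_T3 hFc
        have e : ∀ x, K * (3 * θ / ε * Dcap * (F x + wM) + Dcap ^ 2 * ε / 2) =
            K * (3 * θ / ε * Dcap) * F x + K * (3 * θ / ε * Dcap * wM + Dcap ^ 2 * ε / 2) := fun x => by ring
        simp_rw [e]
        rw [integral_add (hFi.const_mul _) (integrable_const _), integral_const_mul, integral_const, probReal_univ,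
          one_smul, hF, integral_blockShare hadm N p S]
        ring

end XIntegral

/-! ## The position marginal of the local Gibbs law at constant profiles -/

section Gibbs

variable {ψ : ℕ → T3 → ℝ} {ℓ : ℕ → ℝ} {γ C : ℝ} {φ : ℕ → T3 → ℝ} (a : ℝ) (u : V3) {θ : ℝ}

/-- The Gibbs expectation of the `x`-integrated Reynolds density, given a density cap on the hard-sphere domain and a
configuration-uniform bound `δ` on the mean cell self-share. -/
theorem lintegral_gibbs_le (hθ : 0 < θ) (ha : 0 ≤ a) (hψ : CellKernel ψ ℓ) (hadm : AdmissibleKernel γ C φ) {σ : ℝ}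
    (N : ℕ) (Φ : Flow σ N) {Dcap ε δ : ℝ} (hε : 0 < ε) (hDcap : 0 ≤ Dcap)
    (hcap : ∀ z ∈ hardSphereDomain (Torus.geometry (Fin 3)) (N + 1) (hsDiameter σ N), ∀ x : T3,
      ((N + 1 : ℕ) : ℝ)⁻¹ * ∑ i, wgtC N φ z x i ≤ Dcap)
    (hδ : ∀ w : Cfg N, ((N + 1 : ℕ) : ℝ)⁻¹ * ∑ i : Fin (N + 1), ∑ j : Fin (N + 1),
      (wgtC N ψ w (w i).1 j / ∑ k, wgtC N ψ w (w i).1 k) ^ 2 ≤ δ)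
    (hprob : IsProbabilityMeasure (localGibbsMeasure σ (fun _ => a) (fun _ => u) (fun _ => θ) N)) :
    ∫⁻ z, (∫⁻ x, ENNReal.ofReal (ethC N φ ψ z x * reyC N φ ψ z x) ∂(volume : Measure T3))
        ∂(localGibbsLaw σ (fun _ => a) (fun _ => u) (fun _ => θ) N Φ) ≤
      ENNReal.ofReal (Real.sqrt (104 * (1 + 2 ^ 16 * ∫ w, ‖w - u‖ ^ 16 ∂gaussMeasure u θ)) *
        (3 * θ / ε * Dcap * (δ + C * ((N : ℝ) + 1) ^ (3 * γ) / ((N + 1 : ℕ) : ℝ)) + Dcap ^ 2 * ε / 2)) := by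
  haveI := hprob
  have hφc : Continuous (φ N) := (hadm.1 N).continuous
  have hψc : Continuous (ψ N) := hψ.1 N
  have hC0 : 0 ≤ C := Pointwise.admissible_C_nonneg hadm
  have hca : Continuous (fun _ : T3 => a) := continuous_const
  have hcθ : Continuous (fun _ : T3 => θ) := continuous_const
  have hcu : Continuous (fun _ : T3 => u) := continuous_const
  set B : ℝ≥0∞ := ENNReal.ofReal (Real.sqrt (104 * (1 + 2 ^ 16 * ∫ w, ‖w - u‖ ^ 16 ∂gaussMeasure u θ)) *
    (3 * θ / ε * Dcap * (δ + C * ((N : ℝ) + 1) ^ (3 * γ) / ((N + 1 : ℕ) : ℝ)) + Dcap ^ 2 * ε / 2)) with hB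
  -- Step 1: admissible positions `p`: all blocks obey the cap, the mean self-share is `≤ δ`
  have hfix : ∀ p : Fin (N + 1) → T3, p ∈ posDomain (hsDiameter σ N) (N + 1) →
      ∫⁻ v, ∫⁻ x, ENNReal.ofReal (ethC N φ ψ (zipConfig (p, v)) x * reyC N φ ψ (zipConfig (p, v)) x)
        ∂(volume : Measure T3) ∂(Measure.pi fun _ : Fin (N + 1) => gaussMeasure u θ) ≤ B := by
    intro p hp
    have hz : zipConfig (p, (0 : Fin (N + 1) → V3)) ∈
        hardSphereDomain (Torus.geometry (Fin 3)) (N + 1) (hsDiameter σ N) :=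
      (zipConfig_mem_hardSphereDomain_iff (hsDiameter σ N) p 0).2 hp
    have hcapx : ∀ x : T3, (∑ j, φ N (p j - x)) / ((N + 1 : ℕ) : ℝ) ≤ Dcap := fun x => by
      have h := hcap _ hz x
      simp_rw [EqRung.wgtC_zipConfig] at h
      rwa [div_eq_inv_mul]
    have hδp : ((N + 1 : ℕ) : ℝ)⁻¹ * ∑ k, ∑ j, (ψ N (p j - p k) / ∑ m, ψ N (p m - p k)) ^ 2 ≤ δ := by
      have h := hδ (zipConfig (p, (0 : Fin (N + 1) → V3)))
      simpa [wgtC, zipConfig_apply] using h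
    refine (lintegral_lintegral_zip_le u hθ hψ hadm N p hε hDcap hcapx).trans (ENNReal.ofReal_le_ofReal ?_)
    have hK0 := Real.sqrt_nonneg (104 * (1 + 2 ^ 16 * ∫ w, ‖w - u‖ ^ 16 ∂gaussMeasure u θ))
    have hA0 : 0 ≤ 3 * θ / ε * Dcap := by positivity
    gcongr
  -- Step 2: disintegrate the local Gibbs law
  rw [localGibbsLaw_eq]
  have hG : Measurable fun z : Cfg N => ∫⁻ x, ENNReal.ofReal (ethC N φ ψ z x * reyC N φ ψ z x) ∂(volume : Measure T3) :=
    measurable_lintegral_ethC_mul_reyC hφc hψc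
  have hZm : Measurable fun q : Fin (N + 1) → T3 => ENNReal.ofReal
      ((canonicalPartition (Torus.geometry (Fin 3)) (hsDiameter σ N) (N + 1)
        (localGibbsProfile (fun _ => a) (fun _ => u) (fun _ => θ)))⁻¹ *
          posWeight (fun _ => a) (hsDiameter σ N) (N + 1) q) :=
    ((measurable_posWeight hca _ _).const_mul _).ennreal_ofReal
  rw [lintegral_localGibbsMeasure hca hcθ hcu (fun _ => ha) (fun _ => hθ) σ N hG]
  calc _ ≤ ∫⁻ q : Fin (N + 1) → T3, ENNReal.ofReal
        ((canonicalPartition (Torus.geometry (Fin 3)) (hsDiameter σ N) (N + 1)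
          (localGibbsProfile (fun _ => a) (fun _ => u) (fun _ => θ)))⁻¹ *
            posWeight (fun _ => a) (hsDiameter σ N) (N + 1) q) * B := by
        refine lintegral_mono fun q => ?_
        by_cases hq : q ∈ posDomain (hsDiameter σ N) (N + 1)
        · exact mul_le_mul_right (hfix q hq) _
        · have h0 : posWeight (fun _ : T3 => a) (hsDiameter σ N) (N + 1) q = 0 := by
            rw [posWeight, Set.indicator_of_notMem hq]
          rw [h0, mul_zero, ENNReal.ofReal_zero, zero_mul, zero_mul]
    _ = B := by
        rw [lintegral_mul_const _ hZm, lintegral_posWeight_eq_one hca hcθ hcu (fun _ => ha) (fun _ => hθ) σ N, one_mul]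

/-- The kernel-height rate `w_max/(N+1) = C (N+1)^{3γ} / (N+1) → 0` for `3γ < 1`. -/
theorem tendsto_wmax_div {γ C : ℝ} (hγ3 : 3 * γ < 1) :
    Tendsto (fun N : ℕ => C * ((N : ℝ) + 1) ^ (3 * γ) / ((N + 1 : ℕ) : ℝ)) atTop (𝓝 0) := by
  have hcast : Tendsto (fun N : ℕ => ((N + 1 : ℕ) : ℝ)) atTop atTop :=
    tendsto_natCast_atTop_atTop.comp (tendsto_add_atTop_nat 1)
  have h1 : Tendsto (fun N : ℕ => C * ((N + 1 : ℕ) : ℝ) ^ (3 * γ - 1)) atTop (𝓝 (C * 0)) :=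
    ((tendsto_rpow_neg_atTop (by linarith : 0 < -(3 * γ - 1))).comp hcast |>.congr fun N => by
      simp).const_mul C
  rw [mul_zero] at h1
  refine h1.congr fun N => ?_
  have hM : (0 : ℝ) < ((N + 1 : ℕ) : ℝ) := by positivity
  have hc : ((N : ℝ) + 1) = ((N + 1 : ℕ) : ℝ) := (Nat.cast_succ N).symm
  rw [hc, Real.rpow_sub hM, Real.rpow_one, mul_div_assoc]

/-- **MAIN STATIC RESULT.** At constant profiles `(a, u, θ)` with `0 < a`, `0 < θ`, for `0 < σ < 1/2`, an admissible block
kernel family and a cell kernel family: for every `η > 0`, eventually in `N`, for every flow,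
`E_{G_N} ∫ₓ ethC · reyC ≤ η` (lower integrals). -/
theorem exists_lintegral_reynolds_le (hθ : 0 < θ) (ha : 0 < a) {σ : ℝ} (hσ : 0 < σ) (hσ' : σ < 2⁻¹)
    (hψ : CellKernel ψ ℓ) (hadm : AdmissibleKernel γ C φ) (hγ : 0 < γ) (hγ' : γ ≤ 1 / 15) {η : ℝ} (hη : 0 < η) :
    ∃ N₁ : ℕ, ∀ N : ℕ, N₁ ≤ N → ∀ Φ : Flow σ N,
      ∫⁻ z, (∫⁻ x, ENNReal.ofReal (ethC N φ ψ z x * reyC N φ ψ z x) ∂(volume : Measure T3))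
          ∂(localGibbsLaw σ (fun _ => a) (fun _ => u) (fun _ => θ) N Φ) ≤ ENNReal.ofReal η := by
  have hca : Continuous (fun _ : T3 => a) := continuous_const
  have hcθ : Continuous (fun _ : T3 => θ) := continuous_const
  have hcu : Continuous (fun _ : T3 => u) := continuous_const
  set K : ℝ := Real.sqrt (104 * (1 + 2 ^ 16 * ∫ w, ‖w - u‖ ^ 16 ∂gaussMeasure u θ)) with hK
  have hK0 : 0 ≤ K := Real.sqrt_nonneg _
  have hC0 : 0 ≤ C := Pointwise.admissible_C_nonneg hadm
  set Dcap : ℝ := 27 * C / σ ^ 3 with hDcap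
  have hD0 : 0 ≤ Dcap := by positivity
  -- the arithmetic–geometric-mean parameter: `K Dcap² ε/2 ≤ η/2`
  set ε : ℝ := η / (K * Dcap ^ 2 + 1) with hε
  have hε0 : 0 < ε := by positivity
  have hE : K * (Dcap ^ 2 * ε / 2) ≤ η / 2 := by
    have h1 : K * Dcap ^ 2 / (K * Dcap ^ 2 + 1) ≤ 1 := div_le_one_of_le₀ (by linarith) (by positivity)
    calc K * (Dcap ^ 2 * ε / 2) = K * Dcap ^ 2 / (K * Dcap ^ 2 + 1) * (η / 2) := by rw [hε]; ring
      _ ≤ 1 * (η / 2) := by gcongr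
      _ = η / 2 := one_mul _
  set A : ℝ := 3 * θ / ε * Dcap with hA
  have hA0 : 0 ≤ A := by positivity
  -- the self-share and kernel-rate threshold: `K A (δ + δ) ≤ η/2`
  set δ : ℝ := η / (4 * (K * A + 1)) with hδ
  have hδ0 : 0 < δ := by positivity
  have hKA : K * A * (δ + δ) ≤ η / 2 := by
    have h1 : K * A / (K * A + 1) ≤ 1 := div_le_one_of_le₀ (by linarith) (by positivity)
    calc K * A * (δ + δ) = K * A / (K * A + 1) * (η / 2) := by rw [hδ]; field_simp; ring
      _ ≤ 1 * (η / 2) := by gcongr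
      _ = η / 2 := one_mul _
  obtain ⟨N₀, hN₀⟩ := stub_reynolds_packing_anchor ψ ℓ hψ δ hδ0
  obtain ⟨Nc, hcap⟩ := TimeZero.density_cap hadm hγ hγ' hσ hσ'
  have hwm : ∀ᶠ N : ℕ in atTop, C * ((N : ℝ) + 1) ^ (3 * γ) / ((N + 1 : ℕ) : ℝ) < δ :=
    (tendsto_order.1 (tendsto_wmax_div (C := C) (by linarith))).2 δ hδ0
  obtain ⟨Nw, hNw⟩ := eventually_atTop.1 hwm
  refine ⟨max N₀ (max Nc Nw), fun N hN Φ => ?_⟩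
  have hN0 : N₀ ≤ N := (le_max_left _ _).trans hN
  have hNc : Nc ≤ N := ((le_max_left _ _).trans (le_max_right _ _)).trans hN
  have hNw' : Nw ≤ N := ((le_max_right _ _).trans (le_max_right _ _)).trans hN
  have hσ2 : σ ≤ 1 / 2 := by rw [one_div]; exact hσ'.le
  have hprob := isProbabilityMeasure_localGibbsMeasure hca hcθ hcu (fun _ => ha) (fun _ => hθ) hσ2 N
  refine (lintegral_gibbs_le a u hθ ha.le hψ hadm N Φ hε0 hD0 (hcap N hNc) (hN₀ N hN0) hprob).trans
    (ENNReal.ofReal_le_ofReal ?_)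
  have hwM : C * ((N : ℝ) + 1) ^ (3 * γ) / ((N + 1 : ℕ) : ℝ) ≤ δ := (hNw N hNw').le
  have hwM0 : 0 ≤ C * ((N : ℝ) + 1) ^ (3 * γ) / ((N + 1 : ℕ) : ℝ) :=
    div_nonneg (mul_nonneg hC0 (Real.rpow_nonneg (by positivity) _)) (by positivity)
  calc K * (3 * θ / ε * Dcap * (δ + C * ((N : ℝ) + 1) ^ (3 * γ) / ((N + 1 : ℕ) : ℝ)) + Dcap ^ 2 * ε / 2)
      = K * A * (δ + C * ((N : ℝ) + 1) ^ (3 * γ) / ((N + 1 : ℕ) : ℝ)) + K * (Dcap ^ 2 * ε / 2) := by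
        rw [hA]; ring
    _ ≤ K * A * (δ + δ) + η / 2 := by gcongr
    _ ≤ η / 2 + η / 2 := by linarith [hKA]
    _ = η := by ring

end Gibbs

end Reynolds

namespace Reynolds

/-- `ENNReal.ofReal` of the Reynolds functional along a good orbit is below the iterated LOWER integral of the
Reynolds density (Bochner junk only empties the deviation event). -/
theorem ofReal_reynInt_le {σ : ℝ} (N : ℕ) (Φ : Flow σ N) (φ ψ : ℕ → T3 → ℝ) (t : ℝ) (z : Cfg N) :
    ENNReal.ofReal (ReynInt σ N Φ φ ψ t z) ≤
      ∫⁻ s in Icc 0 t, ∫⁻ x, ENNReal.ofReal (ethC N φ ψ (Φ.flow s z) x * reyC N φ ψ (Φ.flow s z) x)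
        ∂(volume : Measure T3) := by
  unfold ReynInt
  refine (ofReal_integral_le_lintegral _).trans (lintegral_mono fun s => ?_)
  exact ofReal_integral_le_lintegral _

/-- **THE EQUILIBRIUM RUNG OF `stub_reynolds`.** At constant profiles `(a, θ, u)`, `0 < a`, `0 < θ`, for every
`0 < σ < 1/2`, every hard-sphere flow family, every admissible block kernel family, every cell kernel family, every
`t > 0` and `κ > 0`: `P_N{κ < ReynInt} → 0` under the local Gibbs law — unconditionally. -/
theorem reynolds_const (a θ : ℝ) (u : V3) (ha : 0 < a) (hθ : 0 < θ) {σ : ℝ} (hσ : 0 < σ) (hσ' : σ < 2⁻¹)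
    (Φ : Flows σ) {γ C : ℝ} {φ : ℕ → T3 → ℝ} (hγ : 0 < γ) (hγ' : γ ≤ 1 / 15) (hadm : AdmissibleKernel γ C φ)
    {ψ : ℕ → T3 → ℝ} {ℓ : ℕ → ℝ} (hψ : CellKernel ψ ℓ) {t : ℝ} (ht : 0 < t) {κ : ℝ} (hκ : 0 < κ) :
    Tendsto (fun N : ℕ => localGibbsLaw σ (fun _ => a) (fun _ => u) (fun _ => θ) N (Φ N)
      {z | κ < ReynInt σ N (Φ N) φ ψ t z}) atTop (𝓝 0) := by
  have hφc : ∀ N, Continuous (φ N) := fun N => (hadm.1 N).continuous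
  have hψc : ∀ N, Continuous (ψ N) := fun N => hψ.1 N
  have hσ2 : σ ≤ 1 / 2 := by rw [one_div]; exact hσ'.le
  -- the laws, the modified flow, the `x`-integrated density
  set G : (N : ℕ) → Measure (Cfg N) := fun N =>
    localGibbsLaw σ (fun _ => a) (fun _ => u) (fun _ => θ) N (Φ N) with hGdef
  haveI hprob : ∀ N, IsProbabilityMeasure (G N) := fun N =>
    isProbabilityMeasure_localGibbsLaw continuous_const continuous_const continuous_const (fun _ => ha)
      (fun _ => hθ) hσ2 N (Φ N)
  set fm : (N : ℕ) → ℝ × Cfg N → Cfg N := fun N p =>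
    if p.2 ∈ (Φ N).good then (Φ N).flow p.1 p.2 else p.2 with hfmdef
  set Y : (N : ℕ) → Cfg N → ℝ≥0∞ := fun N z =>
    ∫⁻ x, ENNReal.ofReal (ethC N φ ψ z x * reyC N φ ψ z x) ∂(volume : Measure T3) with hYdef
  have hgood : ∀ N, G N (Φ N).goodᶜ = 0 := fun N =>
    localGibbsLaw_absolutelyContinuous σ _ _ _ N (Φ N) (Φ N).measure_compl_good
  have hgoodae : ∀ N, ∀ᵐ z ∂G N, z ∈ (Φ N).good := by
    intro N
    filter_upwards [measure_eq_zero_iff_ae_notMem.1 (hgood N)] with z hz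
    simpa using hz
  have hfm_good : ∀ N s, ∀ z ∈ (Φ N).good, fm N (s, z) = (Φ N).flow s z := fun N s z hz => if_pos hz
  have hfm_meas : ∀ N, Measurable (fm N) := fun N => HemisphereAffineSlaving.measurable_flowMod Φ N
  have hY : ∀ N, Measurable (Y N) := fun N => measurable_lintegral_ethC_mul_reyC (hφc N) (hψc N)
  -- the time-integrated functional `Z` and its measurability
  set Z : (N : ℕ) → Cfg N → ℝ≥0∞ := fun N z => ∫⁻ s in Icc 0 t, Y N (fm N (s, z)) with hZdef
  have hYfm : ∀ N, Measurable fun q : Cfg N × ℝ => Y N (fm N (q.2, q.1)) := fun N =>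
    (hY N).comp ((hfm_meas N).comp (measurable_snd.prodMk measurable_fst))
  have hZ : ∀ N, Measurable (Z N) := fun N => (hYfm N).lintegral_prod_right'
  -- Step 1: the deviation event is inside `{κ ≤ Z}` up to the null bad set
  have hev : ∀ N, G N {z | κ < ReynInt σ N (Φ N) φ ψ t z} ≤ G N {z | ENNReal.ofReal κ ≤ Z N z} := by
    intro N
    have hincl : {z | κ < ReynInt σ N (Φ N) φ ψ t z} ⊆ {z | ENNReal.ofReal κ ≤ Z N z} ∪ (Φ N).goodᶜ := by
      intro z hz
      by_cases hg : z ∈ (Φ N).good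
      · left
        simp only [mem_setOf_eq] at hz ⊢
        have hZz : Z N z = ∫⁻ s in Icc 0 t, Y N ((Φ N).flow s z) := by
          simp only [hZdef, hfm_good N _ z hg]
        rw [hZz]
        exact (ENNReal.ofReal_le_ofReal hz.le).trans (ofReal_reynInt_le N (Φ N) φ ψ t z)
      · right; exact hg
    calc G N {z | κ < ReynInt σ N (Φ N) φ ψ t z}
        ≤ G N ({z | ENNReal.ofReal κ ≤ Z N z} ∪ (Φ N).goodᶜ) := measure_mono hincl
      _ ≤ G N {z | ENNReal.ofReal κ ≤ Z N z} + G N (Φ N).goodᶜ := measure_union_le _ _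
      _ = _ := by rw [hgood N, add_zero]
  -- Step 2: Markov, Tonelli in `(z, s)` and invariance slice by slice
  have hmarkov : ∀ N, G N {z | ENNReal.ofReal κ ≤ Z N z} ≤ (∫⁻ z, Z N z ∂G N) / ENNReal.ofReal κ := fun N =>
    meas_ge_le_lintegral_div (hZ N).aemeasurable (ENNReal.ofReal_pos.2 hκ).ne' ENNReal.ofReal_ne_top
  have hswap : ∀ N, ∫⁻ z, Z N z ∂G N = ∫⁻ s in Icc 0 t, ∫⁻ z, Y N z ∂G N := by
    intro N
    rw [hZdef]
    dsimp only
    rw [lintegral_lintegral_swap (hYfm N).aemeasurable]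
    refine setLIntegral_congr_fun measurableSet_Icc fun s _ => ?_
    calc ∫⁻ z, Y N (fm N (s, z)) ∂G N = ∫⁻ z, Y N ((Φ N).flow s z) ∂G N := by
          refine lintegral_congr_ae ?_
          filter_upwards [hgoodae N] with z hz
          rw [hfm_good N s z hz]
      _ = ∫⁻ z, Y N z ∂G N := lintegral_comp_flow_localGibbsLaw_const σ a θ u N (Φ N) s (hY N)
  -- Step 3: the static input, and the limit
  rw [ENNReal.tendsto_nhds_zero]
  intro e he
  by_cases htop : e = ⊤
  · exact Eventually.of_forall fun N => htop ▸ le_top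
  have he' : 0 < e.toReal := ENNReal.toReal_pos he.ne' htop
  set η : ℝ := e.toReal * κ / (2 * t) with hη
  have hη0 : 0 < η := by positivity
  obtain ⟨N₁, hN₁⟩ := exists_lintegral_reynolds_le a u hθ ha hσ hσ' hψ hadm hγ hγ' hη0
  refine eventually_atTop.2 ⟨N₁, fun N hN => ?_⟩
  have hstat : ∫⁻ z, Y N z ∂G N ≤ ENNReal.ofReal η := hN₁ N hN (Φ N)
  have hvol : ∫⁻ _s in Icc 0 t, ENNReal.ofReal η ∂(volume : Measure ℝ) = ENNReal.ofReal η * ENNReal.ofReal t := by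
    rw [setLIntegral_const, Real.volume_Icc, sub_zero]
  calc G N {z | κ < ReynInt σ N (Φ N) φ ψ t z} ≤ G N {z | ENNReal.ofReal κ ≤ Z N z} := hev N
    _ ≤ (∫⁻ z, Z N z ∂G N) / ENNReal.ofReal κ := hmarkov N
    _ = (∫⁻ s in Icc 0 t, ∫⁻ z, Y N z ∂G N) / ENNReal.ofReal κ := by rw [hswap N]
    _ ≤ (∫⁻ _s in Icc 0 t, ENNReal.ofReal η ∂(volume : Measure ℝ)) / ENNReal.ofReal κ := by
        gcongr
    _ = ENNReal.ofReal (η * t / κ) := by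
        rw [hvol, ← ENNReal.ofReal_mul hη0.le, ENNReal.ofReal_div_of_pos hκ]
    _ = ENNReal.ofReal (e.toReal / 2) := by
        congr 1
        rw [hη]
        field_simp
    _ ≤ ENNReal.ofReal e.toReal := ENNReal.ofReal_le_ofReal (by linarith)
    _ = e := ENNReal.ofReal_toReal htop

end Reynolds

/-! ## The registered helper `stub_reynolds_const` (equilibrium rung of `stub_reynolds`) -/

open Reynolds in
/-- ANCHOR / HELPER (`stub_reynolds_const`, registered on the crux item): the statement of `stub_reynolds` at CONSTANT
profiles holds unconditionally — for `0 < a`, `0 < θ`, every `0 < σ < 1/2`, every flow family, every admissible block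
kernel family, every cell kernel family, `t > 0`, `κ > 0`: `P_N{κ < ReynInt} → 0` under `localGibbsLaw σ a u θ N (Φ N)`. -/
theorem stub_reynolds_const : ∀ (a θ : ℝ) (u : V3), 0 < a → 0 < θ → ∀ σ : ℝ, 0 < σ → σ < 2⁻¹ →
    ∀ (Φ : Flows σ) (γ C : ℝ) (φ : ℕ → T3 → ℝ), 0 < γ → γ ≤ 1 / 15 → AdmissibleKernel γ C φ →
      ∀ (ψ : ℕ → T3 → ℝ) (ℓ : ℕ → ℝ), CellKernel ψ ℓ → ∀ t : ℝ, 0 < t → ∀ κ : ℝ, 0 < κ →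
        Tendsto (fun N : ℕ => localGibbsLaw σ (fun _ => a) (fun _ => u) (fun _ => θ) N (Φ N)
          {z | κ < ReynInt σ N (Φ N) φ ψ t z}) atTop (𝓝 0) :=
  fun a θ u ha hθ _ hσ hσ' Φ _ _ _ hγ hγ' hadm _ _ hψ _ ht _ hκ =>
    reynolds_const a θ u ha hθ hσ hσ' Φ hγ hγ' hadm hψ ht hκ

end

end Summit.AtomisticToContinuum.HydrodynamicLimit.Theorems.SustainedAnisotropy
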